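import Summits.QuantumFields.YangMills.Theorems.FemtoTransferGapLevelsDecay
import Summits.QuantumFields.YangMills.Theorems.FemtoTransferGapRungW1up
import Literature.MathematicalPhysics.QuantumFieldTheory.Balaban1983to89.B6TowerSums
import HarnessLib

/-!
# Item stmt-QuantumFields-20204 `OneSiteTail` (child of crux RED, skeleton «KTR» rev 8 stub `TT.stub_oneSiteTail`):
# glue G1 — «Hilbert–Schmidt ratio bound ∧ WINDOWED Laplace-summable floor ⟹ uniform normalised-trace bound»

Second glue module of the split of the one-site tail bound (ideator-2 memo `STUB-READING-oneSiteTail-ideator2.md` on stmt-QuantumFields-19978,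
§2; seat ym-luscher-20007-p2 g4).  With `x_k(B) = levelValue su2Rep 1 B k / levelValue su2Rep 1 B 0` (normalised one-site transfer values,
`L = 1`, `SU(2)`) and `λ_b = bareLambda`:

* HS (S1): `Σ_{j<n} x_j(B)² ≤ C·B^q` for all `n`, all `B ≥ B0` — a polynomial Hilbert–Schmidt ratio bound (crude; from `K_B ≤ e^{6B}` pointwise and
  the quasimode floor `λ_0 ≥ linkC(B)³ e^{−E₀λ_b − C₀λ_b²}` of the proved crux ONE; companion module).
* WINDOWED FLOOR (S2, window form of the route owner's `OneSiteDomination`): for every window constant `c₁ > 0` there is a Laplace-summable profile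
  `g ≥ 0` (`Σ_k e^{−t g(k)} < ∞` for every `t > 0`) with `λ_k(B) ≤ e^{−λ_b · min(g(k), c₁ log B)} λ_0(B)` for all `k` and all `B ≥ B0(c₁)` — the
  domination is only asked UP TO femto energy `c₁ log B` (the semiclassical window), which is what ONE's AbsUpper lane run in subspace mode delivers;
  above the window nothing is claimed.
* CONCLUSION (S0, the hypothesis of `OSTail.oneSiteTail_of_traceBound`): for every `s > 0` a bound `Σ_k x_k(B)^T ≤ Z(s)` (with summability) for
  all `B ≥ B0(s)` and all `T` with `s ≤ 2Tλ_b(B)`.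

Proof (`traceBound_of_hs_of_windowFloor`): take `c₁ = 4(q+1)/s`; for `λ_b ≤ s/8` one has `T ≥ 4` and `(T−2)λ_b ≥ s/4`, so
`x_k^T = x_k^{T−2} x_k² ≤ e^{−(s/4) min(g_k, c₁ log B)} x_k² ≤ (e^{−(s/4) g_k} + B^{−(q+1)}) x_k² ≤ e^{−(s/4) g_k} + B^{−(q+1)} x_k²`, and summing,
`Σ_k x_k^T ≤ Σ_k e^{−(s/4)g_k} + C B^q / B^{q+1} ≤ Σ_k e^{−(s/4) g_k} + max C 0` for `B ≥ 1`.  No binning, no counting function.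
HONEST FRAMING: elementary; neither HS nor the windowed floor is proved here; femto rung R2b1 (one-site lattice quantum mechanics of the
three-matrix `SU(2)` model); not infinite volume, not a mass gap, not Clay.  References: Lüscher 1983 §1; Simon 1983 (Ann. Phys. 146) Thm. 1.1.
-/

set_option autoImplicit false

noncomputable section

open Filter Topology
open Literature.MathematicalPhysics.QuantumFieldTheory
open Literature.MathematicalPhysics.QuantumLattice
open Literature.Analysis.OperatorTheory.YMMatrixModel

namespace Summit.QuantumFields.YangMills.Theorems.FemtoTransferGap.OSTail

/-- `0 ≤ x_k(B)` (`B ≥ 0`). -/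
theorem xval_nonneg {B : ℝ} (hB : 0 ≤ B) (k : ℕ) : 0 ≤ levelValue su2Rep 1 B k / levelValue su2Rep 1 B 0 :=
  div_nonneg (levelValue_su2Rep_nonneg 1 hB k) (levelValue_zero_su2Rep_pos 1 B).le

/-- `x_k(B) ≤ 1` (`B > 0`). -/
theorem xval_le_one {B : ℝ} (hB : 0 < B) (k : ℕ) : levelValue su2Rep 1 B k / levelValue su2Rep 1 B 0 ≤ 1 := by
  rw [div_le_one (levelValue_zero_su2Rep_pos 1 B)]
  exact levelValue_le_of_le (L := 1) hB (Nat.zero_le k)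

/-- ★ **Glue G1: HS ratio bound ∧ windowed Laplace-summable floor ⟹ uniform normalised-trace bound** (the hypothesis of
`OSTail.oneSiteTail_of_traceBound`). -/
theorem traceBound_of_hs_of_windowFloor
    (hHS : ∃ C : ℝ, ∃ q : ℕ, ∃ B0 : ℝ, ∀ B : ℝ, B0 ≤ B → ∀ n : ℕ,
      ∑ j ∈ Finset.range n, (levelValue su2Rep 1 B j / levelValue su2Rep 1 B 0) ^ 2 ≤ C * B ^ q)
    (hW : ∀ c₁ : ℝ, 0 < c₁ → ∃ g : ℕ → ℝ, (∀ k, 0 ≤ g k) ∧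
      (∀ t : ℝ, 0 < t → Summable fun k : ℕ => Real.exp (-t * g k)) ∧
      ∃ B0 : ℝ, ∀ B : ℝ, B0 ≤ B → ∀ k : ℕ,
        levelValue su2Rep 1 B k ≤ Real.exp (-(bareLambda B * min (g k) (c₁ * Real.log B))) * levelValue su2Rep 1 B 0) :
    ∀ s : ℝ, 0 < s → ∃ Z B0 : ℝ, ∀ B : ℝ, B0 ≤ B → ∀ T : ℕ,
      s ≤ 2 * ((T : ℝ) * bareLambda B) →
        Summable (fun k : ℕ => (levelValue su2Rep 1 B k / levelValue su2Rep 1 B 0) ^ T) ∧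
        ∑' k : ℕ, (levelValue su2Rep 1 B k / levelValue su2Rep 1 B 0) ^ T ≤ Z := by
  intro s hs
  obtain ⟨C, q, B1, hHS1⟩ := hHS
  have hc₁ : 0 < 4 * ((q : ℝ) + 1) / s := by positivity
  obtain ⟨g, hg0, hgsum, B2, hfloor⟩ := hW (4 * ((q : ℝ) + 1) / s) hc₁
  have hs4 : 0 < s / 4 := by positivity
  have hG : Summable (fun k => Real.exp (-(s / 4) * g k)) := hgsum _ hs4
  have hs8 : 0 < s / 8 := by positivity
  refine ⟨(∑' k, Real.exp (-(s / 4) * g k)) + max C 0, max (max B1 B2) (max 1 (2 / (s / 8) ^ 3)),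
    fun B hB T hT => ?_⟩
  have hB1 : B1 ≤ B := le_trans ((le_max_left _ _).trans (le_max_left _ _)) hB
  have hB2 : B2 ≤ B := le_trans ((le_max_right _ _).trans (le_max_left _ _)) hB
  have hBone : 1 ≤ B := le_trans ((le_max_left _ _).trans (le_max_right _ _)) hB
  have hBs : 2 / (s / 8) ^ 3 ≤ B := le_trans ((le_max_right _ _).trans (le_max_right _ _)) hB
  have hBpos : 0 < B := by linarith
  have hlpos : 0 < bareLambda B := bareLambda_pos' hBpos
  have hls : bareLambda B ≤ s / 8 := bareLambda_le_of_le hs8 hBs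
  have hlogB : 0 ≤ Real.log B := Real.log_nonneg hBone
  -- T ≥ 4 ≥ 2
  have hT4 : (4 : ℝ) ≤ T := by
    by_contra h
    rw [not_le] at h
    have h1 : 2 * ((T : ℝ) * bareLambda B) ≤ 2 * ((T : ℝ) * (s / 8)) :=
      mul_le_mul_of_nonneg_left (mul_le_mul_of_nonneg_left hls (Nat.cast_nonneg T)) (by norm_num)
    nlinarith
  have hT2 : 2 ≤ T := by exact_mod_cast (show (2 : ℝ) ≤ T by linarith)
  have hTsub : (((T - 2 : ℕ) : ℝ)) = (T : ℝ) - 2 := by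
    rw [Nat.cast_sub hT2]; norm_num
  have hTl : s / 4 ≤ ((T - 2 : ℕ) : ℝ) * bareLambda B := by
    rw [hTsub]
    nlinarith
  -- the normalised values
  have h0pos : 0 < levelValue su2Rep 1 B 0 := levelValue_zero_su2Rep_pos 1 B
  have hx0 : ∀ k, 0 ≤ levelValue su2Rep 1 B k / levelValue su2Rep 1 B 0 := fun k => xval_nonneg hBpos.le k
  have hx1 : ∀ k, levelValue su2Rep 1 B k / levelValue su2Rep 1 B 0 ≤ 1 := fun k => xval_le_one hBpos k
  -- Hilbert–Schmidt: summability and sum of squares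
  have hsum2 : Summable (fun k : ℕ => (levelValue su2Rep 1 B k / levelValue su2Rep 1 B 0) ^ 2) :=
    summable_of_sum_range_le (fun k => pow_nonneg (hx0 k) 2) (hHS1 B hB1)
  have htsum2 : ∑' k, (levelValue su2Rep 1 B k / levelValue su2Rep 1 B 0) ^ 2 ≤ C * B ^ q :=
    Real.tsum_le_of_sum_range_le (fun k => pow_nonneg (hx0 k) 2) (hHS1 B hB1)
  -- summability of the T-th powers
  have hxT2 : ∀ k, (levelValue su2Rep 1 B k / levelValue su2Rep 1 B 0) ^ T ≤
      (levelValue su2Rep 1 B k / levelValue su2Rep 1 B 0) ^ 2 := fun k => pow_le_pow_of_le_one (hx0 k) (hx1 k) hT2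
  have hsumT : Summable (fun k : ℕ => (levelValue su2Rep 1 B k / levelValue su2Rep 1 B 0) ^ T) :=
    Summable.of_nonneg_of_le (fun k => pow_nonneg (hx0 k) T) hxT2 hsum2
  refine ⟨hsumT, ?_⟩
  -- the window constant: exp(-(s/4)·(c₁ log B)) = (B^(q+1))⁻¹
  have hwin : Real.exp (-(s / 4 * (4 * ((q : ℝ) + 1) / s * Real.log B))) = (B ^ (q + 1))⁻¹ := by
    have h1 : s / 4 * (4 * ((q : ℝ) + 1) / s * Real.log B) = ((q + 1 : ℕ) : ℝ) * Real.log B := by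
      push_cast; field_simp
    rw [h1, Real.exp_neg, Real.exp_nat_mul, Real.exp_log hBpos]
  -- termwise bound
  have hterm : ∀ k, (levelValue su2Rep 1 B k / levelValue su2Rep 1 B 0) ^ T ≤
      Real.exp (-(s / 4) * g k) + (B ^ (q + 1))⁻¹ * (levelValue su2Rep 1 B k / levelValue su2Rep 1 B 0) ^ 2 := by
    intro k
    set x : ℝ := levelValue su2Rep 1 B k / levelValue su2Rep 1 B 0 with hxdef
    set m : ℝ := min (g k) (4 * ((q : ℝ) + 1) / s * Real.log B) with hmdef
    have hm0 : 0 ≤ m := le_min (hg0 k) (by positivity)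
    have hxle : x ≤ Real.exp (-(bareLambda B * m)) := by
      rw [hxdef, div_le_iff₀ h0pos]; exact hfloor B hB2 k
    have hsplit : x ^ T = x ^ (T - 2) * x ^ 2 := by
      rw [← pow_add, Nat.sub_add_cancel hT2]
    have hpow : x ^ (T - 2) ≤ Real.exp (-(s / 4 * m)) := by
      calc x ^ (T - 2) ≤ Real.exp (-(bareLambda B * m)) ^ (T - 2) := pow_le_pow_left₀ (hx0 k) hxle _
        _ = Real.exp (-(((T - 2 : ℕ) : ℝ) * bareLambda B * m)) := by
            rw [← Real.exp_nat_mul]; congr 1; ring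
        _ ≤ Real.exp (-(s / 4 * m)) := by
            refine Real.exp_le_exp.2 ?_
            have := mul_le_mul_of_nonneg_right hTl hm0
            linarith
    have hmin : Real.exp (-(s / 4 * m)) ≤ Real.exp (-(s / 4 * g k)) + (B ^ (q + 1))⁻¹ := by
      rw [← hwin, hmdef]
      exact Literature.MathematicalPhysics.QuantumFieldTheory.Balaban1983to89.B6TowerSums.exp_neg_mul_min_le (s / 4) (g k) _
    have hx2le : x ^ 2 ≤ 1 := pow_le_one₀ (hx0 k) (hx1 k)
    have hx2nn : 0 ≤ x ^ 2 := pow_nonneg (hx0 k) 2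
    have hE0 : 0 ≤ Real.exp (-(s / 4 * g k)) := (Real.exp_pos _).le
    calc x ^ T = x ^ (T - 2) * x ^ 2 := hsplit
      _ ≤ (Real.exp (-(s / 4 * g k)) + (B ^ (q + 1))⁻¹) * x ^ 2 :=
          mul_le_mul_of_nonneg_right (hpow.trans hmin) hx2nn
      _ = Real.exp (-(s / 4 * g k)) * x ^ 2 + (B ^ (q + 1))⁻¹ * x ^ 2 := by ring
      _ ≤ Real.exp (-(s / 4 * g k)) * 1 + (B ^ (q + 1))⁻¹ * x ^ 2 := by
          have := mul_le_mul_of_nonneg_left hx2le hE0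
          linarith
      _ = Real.exp (-(s / 4) * g k) + (B ^ (q + 1))⁻¹ * x ^ 2 := by ring_nf
  -- sum up
  have hsumR : Summable (fun k : ℕ => Real.exp (-(s / 4) * g k) +
      (B ^ (q + 1))⁻¹ * (levelValue su2Rep 1 B k / levelValue su2Rep 1 B 0) ^ 2) :=
    hG.add (hsum2.mul_left _)
  have hCB : (B ^ (q + 1))⁻¹ * (C * B ^ q) ≤ max C 0 := by
    have hBq : 0 < B ^ q := pow_pos hBpos q
    have h1 : (B ^ (q + 1))⁻¹ * (C * B ^ q) = C / B := by
      rw [pow_succ]; field_simp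
    rw [h1]
    by_cases hC : 0 ≤ C
    · calc C / B ≤ C := div_le_self hC hBone
        _ ≤ max C 0 := le_max_left _ _
    · exact le_trans (div_nonpos_of_nonpos_of_nonneg (le_of_lt (lt_of_not_ge hC)) hBpos.le) (le_max_right _ _)
  calc ∑' k, (levelValue su2Rep 1 B k / levelValue su2Rep 1 B 0) ^ T
      ≤ ∑' k, (Real.exp (-(s / 4) * g k) + (B ^ (q + 1))⁻¹ * (levelValue su2Rep 1 B k / levelValue su2Rep 1 B 0) ^ 2) :=
        Summable.tsum_le_tsum hterm hsumT hsumR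
    _ = (∑' k, Real.exp (-(s / 4) * g k)) + (B ^ (q + 1))⁻¹ * ∑' k, (levelValue su2Rep 1 B k / levelValue su2Rep 1 B 0) ^ 2 := by
        rw [hG.tsum_add (hsum2.mul_left _), tsum_mul_left]
    _ ≤ (∑' k, Real.exp (-(s / 4) * g k)) + (B ^ (q + 1))⁻¹ * (C * B ^ q) := by
        have := mul_le_mul_of_nonneg_left htsum2 (inv_nonneg.2 (pow_nonneg hBpos.le (q + 1)))
        linarith
    _ ≤ (∑' k, Real.exp (-(s / 4) * g k)) + max C 0 := by linarith

end Summit.QuantumFields.YangMills.Theorems.FemtoTransferGap.OSTail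

end
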